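import Summits.CriticalPhenomena.CardyFormulaZ2.Theorems.CardyIKTransportCornerLineDescentDiluteInfluenceZeros

/-!
# Stub `stub_DiluteInfluence` (line `symmetric-seed-second-order`, crux `CardyIKTransport.CornerLineDescent`,
# stmt-CriticalPhenomena-10964), groundwork part 2: counting the splitting faces; the stub REDUCED to the
# signed single-dislocation estimate

Vocabulary: `Theorems/CardyIKTransportCornerLineDescentLine.lean` (`influence p R δ f`, `influenceSum p R δ`,
`DiluteBoundOn`); part 1 (`…DiluteInfluenceZeros.lean`) proved that a face with non-zero influence is a SPLITTING face
(`mem_splittingFaces_of_influence_ne_zero`: its row line and its column line both split the lattice window).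

Proved here (§E): `splittingFaces_subset_latticeBox` — if `R.carrier ⊆ B(0, M)` the splitting faces lie in the box
`latticeBox ⌊M/δ⌋₊` of `≤ (2⌊M/δ⌋₊+1)² ≤ (2M+1)² δ⁻²` faces (`card_latticeBox_floor_le`, `0 < δ < 1`), so the Russo sum is
a finite sum (`influenceSum_eq_sum_latticeBox`) and is a priori `≤ (2M+1)² δ⁻²` at every density
(`influenceSum_le_sq_div`); the bookkeeping lemma `influenceSum_le_of_bulk_and_layer` — if off an exceptional set
`E` of `≤ C δ⁻¹` faces every face has `|I_f(p)| ≤ K δ²` and on `E` every face has `|I_f(p)| ≤ K δ`, then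
`Σ_f |I_f(p)| ≤ ((2M+1)² + C) K`; hence `diluteBoundOn_of_bulk_and_layer_bound` — `DiluteBoundOn R c C' κ δ`
eventually in `δ` follows from the SIGNED SINGLE-DISLOCATION BOUND in "bulk + thin layer" form: eventually in `δ`,
an exceptional set `E_δ` of `≤ C δ⁻¹` faces with `|I_f(p)| ≤ C δ^{κ}` on `E_δ` and `|I_f(p)| ≤ C δ^{1+κ}` off
`E_δ`, for all `0 ≤ p ≤ cδ` (`diluteBoundOn_of_uniform_influence_bound` is the case `E_δ = ∅`); and the registered
anchor `stub_DiluteInfluence_of_bulk_and_layer_bound`: that hypothesis, quantified exactly like the stub, implies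
the stub.  Part 3 (`…SummedInfluenceReduction.lean`) runs the same bookkeeping for the dense-regime stub.

What is NOT here: the hypothesis itself — the size exponent `x₀ = 1 + κ > 1` of one annealed dislocation in bond-`ℤ²`
on the renewal grid with `O(c)` further dislocations per line (line card: "annealed Burgers neutrality"; crux workfile
`Disproof.lean` §G(2), §G(4)).  It is the open core of `stub_DiluteInfluence`; numerics at `p = 0` (exact enumeration,
`2n × n` windows, `n = 2, 3, 4`): central `|I_f| = 0.0547, 0.0319, ≈ 0.019`, all of one sign.
-/

noncomputable section

namespace Summit.CriticalPhenomena.CardyFormulaZ2.Theorems.CornerLineDescent.SymmetricSeed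

open scoped BigOperators Topology Classical MeasureTheory ProbabilityTheory ENNReal NNReal symmDiff
open Filter Set Function MeasureTheory
open Literature.Probability.Percolation (sitePercolation bondPercolation half BondConfig embDomainCrossing
  rectangle openGraph openConnIn sitePi bernoulliProp)
open Literature.Probability.LatticeModels
open Literature.Probability.RandomPlanarGeometry

/-! ## §E Counting the splitting faces; the stub reduced to the signed single-dislocation estimate -/

/-- The lattice box `{f | |f₀| ≤ N ∧ |f₁| ≤ N}` as a finset (`(2N+1)²` faces). [folklore] -/
def latticeBox (N : ℕ) : Finset (Site 2) :=
  ((Finset.Icc (-(N : ℤ)) N) ×ˢ (Finset.Icc (-(N : ℤ)) N)).image fun g => ![g.1, g.2]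

/-- A face with both coordinates of modulus `≤ N` lies in `latticeBox N`. [folklore] -/
theorem mem_latticeBox {N : ℕ} {f : Site 2} (h0 : |f 0| ≤ N) (h1 : |f 1| ≤ N) : f ∈ latticeBox N := by
  rw [latticeBox, Finset.mem_image]
  refine ⟨(f 0, f 1), ?_, (vec_eq_iff _ _).2 rfl⟩
  rw [Finset.mem_product, Finset.mem_Icc, Finset.mem_Icc]
  exact ⟨abs_le.1 h0, abs_le.1 h1⟩

/-- `#latticeBox N ≤ (2N+1)²`. [folklore] -/
theorem card_latticeBox_le (N : ℕ) : (latticeBox N).card ≤ (2 * N + 1) ^ 2 := by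
  refine Finset.card_image_le.trans ?_
  rw [Finset.card_product, Int.card_Icc]
  have : ((N : ℤ) + 1 - -(N : ℤ)).toNat = 2 * N + 1 := by omega
  rw [this, sq]

/-- Window cells have coordinates of modulus `≤ M/δ` when `R.carrier ⊆ B(0, M)`. [folklore] -/
theorem abs_coord_le_of_mem_window {R : ConformalRectangle} {δ M : ℝ} (hδ : 0 < δ)
    (hM : ∀ z ∈ R.carrier, ‖z‖ ≤ M) {y : Site 2} (hy : y ∈ window R δ) (i : Fin 2) :
    |((y i : ℤ) : ℝ)| ≤ M / δ := by
  have hz := hM _ hy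
  rw [norm_mul, Complex.norm_real, Real.norm_eq_abs, abs_of_pos hδ] at hz
  rw [le_div_iff₀ hδ, mul_comm]
  refine le_trans ((mul_le_mul_iff_right₀ hδ).2 ?_) hz
  fin_cases i
  · simpa using Complex.abs_re_le_norm ((((y 0 : ℤ) : ℝ) : ℂ) + (((y 1 : ℤ) : ℝ) : ℂ) * Complex.I)
  · simpa using Complex.abs_im_le_norm ((((y 0 : ℤ) : ℝ) : ℂ) + (((y 1 : ℤ) : ℝ) : ℂ) * Complex.I)

/-- `x ∈ farSide a → |a| ≤ |x|`. [folklore] -/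
theorem abs_le_abs_of_mem_farSide {a x : ℤ} (h : x ∈ farSide a) : |a| ≤ |x| := by
  simp only [farSide, Set.mem_setOf_eq] at h
  rcases h with h | h
  · rw [abs_of_nonneg h.1, abs_of_nonneg (h.1.trans h.2.le)]; exact h.2.le
  · rw [abs_of_neg h.1, abs_of_nonpos (h.2.trans h.1.le)]; omega

/-- THE SPLITTING FACES LIE IN A BOX OF `O(δ⁻²)` FACES: if `R.carrier ⊆ B(0, M)` then
`splittingFaces R δ ⊆ latticeBox ⌊M/δ⌋₊`. [folklore] -/
theorem splittingFaces_subset_latticeBox {R : ConformalRectangle} {δ M : ℝ} (hδ : 0 < δ)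
    (hM : ∀ z ∈ R.carrier, ‖z‖ ≤ M) : splittingFaces R δ ⊆ ↑(latticeBox ⌊M / δ⌋₊) := by
  intro f hf
  obtain ⟨⟨⟨v, hv, hv0⟩, -⟩, ⟨w, hw, hw1⟩, -⟩ := hf
  have key : ∀ (a x : ℤ), x ∈ farSide a → |((x : ℤ) : ℝ)| ≤ M / δ → |a| ≤ (⌊M / δ⌋₊ : ℤ) := by
    intro a x hx hxM
    have h1 : ((|a| : ℤ) : ℝ) ≤ M / δ := by
      calc ((|a| : ℤ) : ℝ) ≤ ((|x| : ℤ) : ℝ) := by exact_mod_cast abs_le_abs_of_mem_farSide hx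
        _ = |((x : ℤ) : ℝ)| := Int.cast_abs
        _ ≤ M / δ := hxM
    have h2 : (|a|).toNat ≤ ⌊M / δ⌋₊ := by
      refine Nat.le_floor ?_
      have : (((|a|).toNat : ℤ) : ℝ) = ((|a| : ℤ) : ℝ) := by
        rw [Int.toNat_of_nonneg (abs_nonneg a)]
      calc ((|a|).toNat : ℝ) = (((|a|).toNat : ℤ) : ℝ) := (Int.cast_natCast _).symm
        _ = ((|a| : ℤ) : ℝ) := this
        _ ≤ M / δ := h1
    calc |a| = ((|a|).toNat : ℤ) := (Int.toNat_of_nonneg (abs_nonneg a)).symm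
      _ ≤ (⌊M / δ⌋₊ : ℤ) := by exact_mod_cast h2
  exact mem_latticeBox (key _ _ hv0 (abs_coord_le_of_mem_window hδ hM hv 0))
    (key _ _ hw1 (abs_coord_le_of_mem_window hδ hM hw 1))

/-- Hence the Russo sum is a FINITE sum over the box: `Σ_f |I_f(p)| = Σ_{f ∈ latticeBox ⌊M/δ⌋₊} |I_f(p)|`
for `δ > 0`. [folklore] -/
theorem influenceSum_eq_sum_latticeBox {R : ConformalRectangle} {δ M : ℝ} (hδ : 0 < δ)
    (hM : ∀ z ∈ R.carrier, ‖z‖ ≤ M) (p : ℝ) :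
    influenceSum p R δ = ∑ f ∈ latticeBox ⌊M / δ⌋₊, |influence p R δ f| := by
  unfold influenceSum
  refine finsum_eq_sum_of_support_subset _ fun f hf => ?_
  refine splittingFaces_subset_latticeBox hδ hM
    (mem_splittingFaces_of_influence_ne_zero (p := p) fun h0 => hf ?_)
  simp only [h0, abs_zero]

/-- `#latticeBox ⌊M/δ⌋₊ ≤ (2M+1)² / δ²` for `0 < δ < 1`, `0 ≤ M`: the box has `O(δ⁻²)` faces. [folklore] -/
theorem card_latticeBox_floor_le {δ M : ℝ} (hδ0 : 0 < δ) (hδ1 : δ < 1) (hM : 0 ≤ M) :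
    ((latticeBox ⌊M / δ⌋₊).card : ℝ) ≤ (2 * M + 1) ^ 2 / δ ^ 2 := by
  have h1 : ((latticeBox ⌊M / δ⌋₊).card : ℝ) ≤ ((2 * ⌊M / δ⌋₊ + 1 : ℕ) : ℝ) ^ 2 := by
    exact_mod_cast card_latticeBox_le ⌊M / δ⌋₊
  have h2 : ((2 * ⌊M / δ⌋₊ + 1 : ℕ) : ℝ) ≤ (2 * M + 1) / δ := by
    have hfl : (⌊M / δ⌋₊ : ℝ) ≤ M / δ := Nat.floor_le (div_nonneg hM hδ0.le)
    rw [le_div_iff₀ hδ0]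
    push_cast
    have : (M / δ) * δ = M := div_mul_cancel₀ M hδ0.ne'
    nlinarith
  calc ((latticeBox ⌊M / δ⌋₊).card : ℝ) ≤ ((2 * ⌊M / δ⌋₊ + 1 : ℕ) : ℝ) ^ 2 := h1
    _ ≤ ((2 * M + 1) / δ) ^ 2 := by gcongr
    _ = (2 * M + 1) ^ 2 / δ ^ 2 := div_pow _ _ 2

/-- A PRIORI BOUND at every density `p`: `Σ_f |I_f(p)| ≤ (2M+1)² / δ²` for `0 < δ < 1` and `R.carrier ⊆ B(0, M)`
(each `|I_f(p)| ≤ 1`, and only the faces of `latticeBox ⌊M/δ⌋₊` contribute).  With `stub_Russo` this gives the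
Lipschitz continuity of `p ↦ P_p(A)` at fixed mesh, constant `(2M+1)² δ⁻²`. [folklore] -/
theorem influenceSum_le_sq_div (p : ℝ) {R : ConformalRectangle} {δ M : ℝ} (hδ0 : 0 < δ) (hδ1 : δ < 1)
    (hM0 : 0 ≤ M) (hM : ∀ z ∈ R.carrier, ‖z‖ ≤ M) : influenceSum p R δ ≤ (2 * M + 1) ^ 2 / δ ^ 2 := by
  rw [influenceSum_eq_sum_latticeBox hδ0 hM p]
  refine (Finset.sum_le_card_nsmul _ _ 1 fun f _ => abs_influence_le_one p R δ f).trans ?_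
  rw [nsmul_eq_mul, mul_one]
  exact card_latticeBox_floor_le hδ0 hδ1 hM0

/-- BULK + THIN LAYER BOOKKEEPING (every density `p`).  If `R.carrier ⊆ B(0, M)`, `0 < δ < 1`, and an exceptional
set `E` of at most `C δ⁻¹` faces is given such that every face off `E` has `|I_f(p)| ≤ K δ²` and every face of `E`
has `|I_f(p)| ≤ K δ` (`K ≥ 0` the target size of the whole sum), then `Σ_f |I_f(p)| ≤ ((2M+1)² + C) K`: the faces
of non-zero influence lie in `latticeBox ⌊M/δ⌋₊` (`influenceSum_eq_sum_latticeBox`, `≤ (2M+1)² δ⁻²` of them). [folklore] -/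
theorem influenceSum_le_of_bulk_and_layer {R : ConformalRectangle} {δ M C K p : ℝ} {E : Finset (Site 2)}
    (hδ0 : 0 < δ) (hδ1 : δ < 1) (hM0 : 0 ≤ M) (hM : ∀ z ∈ R.carrier, ‖z‖ ≤ M)
    (hE : (E.card : ℝ) ≤ C * δ⁻¹) (hK : 0 ≤ K) (hbulk : ∀ f ∉ E, |influence p R δ f| ≤ K * δ ^ 2)
    (hlayer : ∀ f ∈ E, |influence p R δ f| ≤ K * δ) :
    influenceSum p R δ ≤ ((2 * M + 1) ^ 2 + C) * K := by
  set B := latticeBox ⌊M / δ⌋₊ with hB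
  rw [influenceSum_eq_sum_latticeBox hδ0 hM p, ← hB,
    ← Finset.sum_sdiff (Finset.inter_subset_left (s₁ := B) (s₂ := E))]
  have hb : ∑ f ∈ B \ (B ∩ E), |influence p R δ f| ≤ (B.card : ℝ) * (K * δ ^ 2) := by
    refine (Finset.sum_le_card_nsmul _ _ (K * δ ^ 2) fun f hf => ?_).trans ?_
    · rw [Finset.mem_sdiff, Finset.mem_inter, not_and] at hf
      exact hbulk f (hf.2 hf.1)
    · rw [nsmul_eq_mul]
      exact mul_le_mul_of_nonneg_right (by exact_mod_cast Finset.card_le_card Finset.sdiff_subset)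
        (mul_nonneg hK (sq_nonneg δ))
  have hl : ∑ f ∈ B ∩ E, |influence p R δ f| ≤ (E.card : ℝ) * (K * δ) := by
    refine (Finset.sum_le_card_nsmul _ _ (K * δ) fun f hf => hlayer f (Finset.mem_inter.1 hf).2).trans ?_
    rw [nsmul_eq_mul]
    exact mul_le_mul_of_nonneg_right (by exact_mod_cast Finset.card_le_card Finset.inter_subset_right)
      (mul_nonneg hK hδ0.le)
  calc ∑ f ∈ B \ (B ∩ E), |influence p R δ f| + ∑ f ∈ B ∩ E, |influence p R δ f|
      ≤ (B.card : ℝ) * (K * δ ^ 2) + (E.card : ℝ) * (K * δ) := add_le_add hb hl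
    _ ≤ (2 * M + 1) ^ 2 / δ ^ 2 * (K * δ ^ 2) + C * δ⁻¹ * (K * δ) :=
        add_le_add (mul_le_mul_of_nonneg_right (card_latticeBox_floor_le hδ0 hδ1 hM0)
          (mul_nonneg hK (sq_nonneg δ))) (mul_le_mul_of_nonneg_right hE (mul_nonneg hK hδ0.le))
    _ = ((2 * M + 1) ^ 2 + C) * K := by field_simp

/-- REDUCTION OF THE STUB TO THE MISSING ESTIMATE ("bulk + thin layer" form).  Suppose that, eventually
in `δ`, there is an exceptional set `E_δ` of at most `C δ⁻¹` faces (e.g. the `O(δ^{-1/2})`-neighbourhoods of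
the four marked points, where the natural single-dislocation size is the boundary two-arm price
`(rδ)^{π/θ} ≫ δ^{1+κ}`, and/or a rectifiable boundary layer) such that for every density `0 ≤ p ≤ cδ`
* every face off `E_δ` has `|I_f(p)| ≤ C δ^{1+κ}` (BULK: signed annealed single-dislocation size exponent
  `x₀ = 1 + κ > 1`),
* every face of `E_δ` has `|I_f(p)| ≤ C δ^{κ}` (LAYER: any positive exponent).
Then `DiluteBoundOn` holds eventually with the same `κ` and `C' = ((2M+1)² + C) C` (`R.carrier ⊆ B(0,M)`), by
`influenceSum_le_of_bulk_and_layer` with `K = C δ^{κ-1}`.  The two bulleted hypotheses are OPEN (line card: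
"annealed Burgers neutrality"); they are the precise content of the stub modulo parts 1–2. [folklore] -/
theorem diluteBoundOn_of_bulk_and_layer_bound (R : ConformalRectangle) (c : ℝ)
    (h : ∃ C κ : ℝ, 0 < κ ∧ ∀ᶠ δ in 𝓝[>] (0:ℝ), ∃ E : Finset (Site 2), (E.card : ℝ) ≤ C * δ⁻¹ ∧
      ∀ p : ℝ, 0 ≤ p → p ≤ c * δ → ∀ f : Site 2,
        (f ∉ E → |influence p R δ f| ≤ C * δ ^ (1 + κ)) ∧ (f ∈ E → |influence p R δ f| ≤ C * δ ^ κ)) :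
    ∃ C κ : ℝ, 0 < κ ∧ ∀ᶠ δ in 𝓝[>] (0:ℝ), DiluteBoundOn R c C κ δ := by
  obtain ⟨C, κ, hκ, hev⟩ := h
  obtain ⟨M, hMpos, hM⟩ := R.isBounded.exists_pos_norm_le
  refine ⟨((2 * M + 1) ^ 2 + C) * C, κ, hκ, ?_⟩
  filter_upwards [hev, Ioo_mem_nhdsGT zero_lt_one] with δ hδ hδ01
  obtain ⟨E, hEcard, hδ⟩ := hδ
  intro p hp0 hpc
  have hδ0 : 0 < δ := hδ01.1
  have hC : 0 ≤ C := by
    have h1 : (0:ℝ) ≤ C * δ⁻¹ := le_trans (Nat.cast_nonneg _) hEcard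
    exact nonneg_of_mul_nonneg_left h1 (inv_pos.2 hδ0)
  have hpow : δ ^ (1 + κ) = δ ^ (κ - 1) * δ ^ 2 := by
    rw [← Real.rpow_two, ← Real.rpow_add hδ0]; congr 1; ring
  have hpow' : δ ^ κ = δ ^ (κ - 1) * δ := by
    rw [← Real.rpow_add_one hδ0.ne']; congr 1; ring
  rw [mul_assoc]
  refine influenceSum_le_of_bulk_and_layer hδ0 hδ01.2 hMpos.le hM hEcard
    (mul_nonneg hC (Real.rpow_nonneg hδ0.le _)) (fun f hf => ?_) fun f hf => ?_
  · rw [mul_assoc, ← hpow]; exact (hδ p hp0 hpc f).1 hf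
  · rw [mul_assoc, ← hpow']; exact (hδ p hp0 hpc f).2 hf

/-- The UNIFORM form of the missing estimate (no exceptional layer, `E_δ = ∅`): if eventually in `δ`, for
every `0 ≤ p ≤ cδ` and EVERY face `f`, `|I_f(p)| ≤ C δ^{1+κ}`, then `DiluteBoundOn` holds with the same
`κ`.  (Caveat for the prover: per-face uniformity is expected to FAIL at the `O(1)` faces nearest the four
marked points, where the response is the boundary two-arm price `≍ δ^{π/θ}`; use the layered form.) [folklore] -/
theorem diluteBoundOn_of_uniform_influence_bound (R : ConformalRectangle) (c : ℝ)
    (h : ∃ C κ : ℝ, 0 < κ ∧ ∀ᶠ δ in 𝓝[>] (0:ℝ), ∀ p : ℝ, 0 ≤ p → p ≤ c * δ →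
      ∀ f : Site 2, |influence p R δ f| ≤ C * δ ^ (1 + κ)) :
    ∃ C κ : ℝ, 0 < κ ∧ ∀ᶠ δ in 𝓝[>] (0:ℝ), DiluteBoundOn R c C κ δ := by
  obtain ⟨C, κ, hκ, hev⟩ := h
  refine diluteBoundOn_of_bulk_and_layer_bound R c ⟨max C 0, κ, hκ, ?_⟩
  filter_upwards [hev, self_mem_nhdsWithin] with δ hδ hδ0
  refine ⟨∅, by simpa using mul_nonneg (le_max_right C 0) (inv_nonneg.2 (le_of_lt hδ0)), ?_⟩
  intro p hp0 hpc f
  exact ⟨fun _ => (hδ p hp0 hpc f).trans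
    (mul_le_mul_of_nonneg_right (le_max_left C 0) (Real.rpow_nonneg (le_of_lt hδ0) _)),
    fun hf => absurd hf (Finset.notMem_empty f)⟩

/-- The stub, CONDITIONALLY on the layered signed single-dislocation bound (quantified exactly like the
stub). [folklore] -/
theorem stub_DiluteInfluence_of_bulk_and_layer_bound : (∀ (R : ConformalRectangle) (c : ℝ), 0 < c → ∃ C κ : ℝ, 0 < κ ∧ ∀ᶠ δ in 𝓝[>] (0:ℝ), ∃ E : Finset (Site 2), (E.card : ℝ) ≤ C * δ⁻¹ ∧ ∀ p : ℝ, 0 ≤ p → p ≤ c * δ → ∀ f : Site 2, (f ∉ E → |influence p R δ f| ≤ C * δ ^ (1 + κ)) ∧ (f ∈ E → |influence p R δ f| ≤ C * δ ^ κ)) → ∀ (R : ConformalRectangle) (c : ℝ), 0 < c → ∃ C κ : ℝ, 0 < κ ∧ ∀ᶠ δ in 𝓝[>] (0:ℝ), DiluteBoundOn R c C κ δ := by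
  intro h R c hc
  exact diluteBoundOn_of_bulk_and_layer_bound R c (h R c hc)

end Summit.CriticalPhenomena.CardyFormulaZ2.Theorems.CornerLineDescent.SymmetricSeed
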